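import Summits.Ventures.PercRepro.Night2ShadowForm
import Summits.Ventures.PercRepro.PhiCredit

/-!
# PercRepro — C-025: THE PROFILE INEQUALITY `C025Profile` and the bridge `c025_of_profile` (night-3, gen 6)

`proofs/NIGHT3-G6-PROFILE.md` (night-3 g6, 2026-08-25): a UNIFORM-IN-`p` strengthening of the rank level-set
inequality.  For a finite matroid `M` on `E` with rank `ρ`, every `q ≥ 0` and every `u > q`,

  (Π_{q,u})   `#{S ⊆ E : ρ(S) = u}  ≥  Σ_{B ⊆ E : ρ(B) = q, ρ(E ∖ B) ≥ u}  C(ρ(B) + ρ(E ∖ B), u) / C(ρ(B) + ρ(E ∖ B), q)`.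

The term with `ρ(E ∖ B) = p` alone is the level-wise form (R1) of `C025` at `(p, q)`, so summing over `q < u < p`
gives `C025` at EVERY `(p, q)` from the single family `(Π_{q,u})`.  Census (exact): every loopless matroid on
`≤ 9` elements (4,788,805 `(q,u)` tests, 0 violations, 200 tight = the large-girth classes), random linear /
graphic / binary / sum–truncation families on `9..12` elements (11,878 tests, 0 violations).  NOT a theorem.

* `Shadow.levelSet M u` — the rank-`u` level (subsets of the ground set `gr M` of rank `u`), `Profile.Rq M q` — the rank-`q`
  sets, `Profile.price M q u B` — the profile price `C(p'+q,u)/C(p'+q,q)` of `B` (`p' = ρ(E ∖ B)`) when `u ≤ p'`, else `0`;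
* `Profile.ProfileIneq M q u` — the inequality `Σ_{B ∈ Rq} price ≤ #levelSet u` (night-2's `Shadow.levelSet`); **`C025Profile`** —
  for every finite matroid and every `q < u`; **`ProfileHall`** — the Hall form (H⁺) over night-2's `Shadow.shadowLevel`, with
  the bridges `profile_of_profileHall : ProfileHall → C025Profile` and `shadowC025Level_of_profileHall : ProfileHall →
  ShadowC025Level` (RULING (uc)(1): H⁺ ⟹ ShadowC025Level ⟹ ShadowC025 ⟹ C025 and H⁺ ⟹ Π ⟹ C025);
* **`c025_of_profile : C025Profile → C025`** — the bridge: drop the terms with `ρ(E ∖ B) ≠ p`, partition the middle level by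
  rank (`card_Yq_eq_sum`), complement (`ncard_U_le_card_Uq`), and `C(p+q,p) = C(p+q,q)` (`phiK_eq_sum_levels`);
* the first proved cases — `(Π_{1,u})` for simple coloop-free matroids (Theorem B′) and `(Π_{q,u})` for girth `≥ u + 1`
  (the G′ analogue) — are in the companion module `C025ProfileCases.lean`.
-/

namespace PercRepro

open scoped Matroid

open Set Finset ThmH

namespace Profile

/-- `Φ(p,q) = Σ_{q<u<p} C(p+q,u)/C(p+q,q)` — the level-wise prices at `ρ(E ∖ B) = p` sum to `Φ`. -/
theorem phiK_eq_sum_levels (p q : ℕ) :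
    phiK p q = ∑ u ∈ Finset.Ioo q p, (Nat.choose (p + q) u : ℚ) / (Nat.choose (p + q) q : ℚ) := by
  unfold phiK
  rw [Finset.sum_div, Nat.choose_symm_add]

/-- `Φ(p,q) ≥ 0`. -/
theorem phiK_nonneg (p q : ℕ) : 0 ≤ phiK p q := by
  unfold phiK
  exact div_nonneg (Finset.sum_nonneg (fun _ _ => Nat.cast_nonneg _)) (Nat.cast_nonneg _)

variable {α : Type*} [DecidableEq α] (M : Matroid α) [M.Finite]

open scoped Classical in
/-- The rank-`q` sets. -/
noncomputable def Rq (q : ℕ) : Finset (Finset α) :=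
  (gr M).powerset.filter (fun B => M.eRk (B : Set α) = (q : ℕ∞))

/-- The PROFILE PRICE of a rank-`q` set `B` at level `u`: with `p' := ρ(E ∖ B)`, `C(p'+q, u) / C(p'+q, q)` if `u ≤ p'`,
and `0` otherwise (the threshold `ρ(E ∖ B) ≥ u`). -/
noncomputable def price (q u : ℕ) (B : Finset α) : ℚ :=
  if (u : ℕ∞) ≤ M.eRk ((gr M \ B : Finset α) : Set α) then
    (Nat.choose ((M.eRk ((gr M \ B : Finset α) : Set α)).toNat + q) u : ℚ) /
      (Nat.choose ((M.eRk ((gr M \ B : Finset α) : Set α)).toNat + q) q : ℚ)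
  else 0

/-- **The profile inequality of `M` at `(q, u)`**: `Σ_{B : ρ(B) = q} price(B) ≤ #{S : ρ(S) = u}`. -/
def ProfileIneq (q u : ℕ) : Prop :=
  ∑ B ∈ Rq M q, price M q u B ≤ ((Shadow.levelSet M u).card : ℚ)

variable {M}

omit [DecidableEq α] in
/-- Membership in night-2's `Shadow.levelSet` (the rank-`u` subsets of the ground set). -/
theorem mem_levelSet {u : ℕ} {S : Finset α} :
    S ∈ Shadow.levelSet M u ↔ S ⊆ gr M ∧ M.eRk (S : Set α) = (u : ℕ∞) := by
  unfold Shadow.levelSet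
  simp only [Finset.mem_filter, Finset.mem_powerset]

omit [DecidableEq α] in
/-- Membership in `Rq`. -/
theorem mem_Rq {q : ℕ} {B : Finset α} : B ∈ Rq M q ↔ B ⊆ gr M ∧ M.eRk (B : Set α) = (q : ℕ∞) := by
  unfold Rq
  simp only [Finset.mem_filter, Finset.mem_powerset]

/-- Prices are nonnegative. -/
theorem price_nonneg (q u : ℕ) (B : Finset α) : 0 ≤ price M q u B := by
  unfold price
  split_ifs
  · exact div_nonneg (Nat.cast_nonneg _) (Nat.cast_nonneg _)
  · exact le_rfl

/-- The bottom sets of `(p, q)` are rank-`q` sets. -/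
theorem Uq_subset_Rq (p q : ℕ) : PerFlat.Uq M p q ⊆ Rq M q := by
  intro B hB
  rw [PerFlat.mem_Uq] at hB
  rw [mem_Rq]
  exact ⟨hB.1, hB.2.1⟩

/-- On a bottom set of `(p, q)` the price at a level `u ≤ p` is `C(p+q,u)/C(p+q,q)`. -/
theorem price_of_mem_Uq {p q u : ℕ} (hu : u ≤ p) {B : Finset α} (hB : B ∈ PerFlat.Uq M p q) :
    price M q u B = (Nat.choose (p + q) u : ℚ) / (Nat.choose (p + q) q : ℚ) := by
  rw [PerFlat.mem_Uq] at hB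
  unfold price
  rw [hB.2.2, ENat.toNat_coe, if_pos (by exact_mod_cast hu)]

omit [DecidableEq α] in
/-- The middle level `Yq` is the disjoint union of the levels `Lq u`, `q < u < p`. -/
theorem card_Yq_eq_sum (p q : ℕ) : (PerFlat.Yq M p q).card = ∑ u ∈ Finset.Ioo q p, (Shadow.levelSet M u).card := by
  classical
  have hmem : ∀ S ∈ PerFlat.Yq M p q, (M.eRk (S : Set α)).toNat ∈ Finset.Ioo q p := by
    intro S hS
    simp only [Finset.mem_filter, PerFlat.Yq, Finset.mem_powerset] at hS
    obtain ⟨_, hq, hp⟩ := hS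
    have hne : M.eRk (S : Set α) ≠ ⊤ := ne_top_of_lt hp
    rw [Finset.mem_Ioo]
    constructor
    · have := hq
      rw [← ENat.coe_toNat hne] at this
      exact_mod_cast this
    · have := hp
      rw [← ENat.coe_toNat hne] at this
      exact_mod_cast this
  rw [Finset.card_eq_sum_card_fiberwise hmem]
  apply Finset.sum_congr rfl
  intro u hu
  rw [Finset.mem_Ioo] at hu
  congr 1
  ext S
  simp only [Finset.mem_filter, PerFlat.Yq, Finset.mem_powerset, mem_levelSet]
  constructor
  · rintro ⟨⟨hS, _, hp⟩, hrk⟩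
    refine ⟨hS, ?_⟩
    have hne : M.eRk (S : Set α) ≠ ⊤ := ne_top_of_lt hp
    rw [← ENat.coe_toNat hne, hrk]
  · rintro ⟨hS, hrk⟩
    refine ⟨⟨hS, ?_, ?_⟩, ?_⟩
    · rw [hrk]; exact_mod_cast hu.1
    · rw [hrk]; exact_mod_cast hu.2
    · rw [hrk, ENat.toNat_coe]

/-- From the profile inequality at `(q, u)` with `q < u ≤ p`: `#Uq(p,q) · C(p+q,u)/C(p+q,q) ≤ #Lq(u)`. -/
theorem card_Uq_mul_le_card_Lq {p q u : ℕ} (hu : u ≤ p) (h : ProfileIneq M q u) :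
    ((PerFlat.Uq M p q).card : ℚ) * ((Nat.choose (p + q) u : ℚ) / (Nat.choose (p + q) q : ℚ)) ≤
      ((Shadow.levelSet M u).card : ℚ) := by
  unfold ProfileIneq at h
  calc ((PerFlat.Uq M p q).card : ℚ) * ((Nat.choose (p + q) u : ℚ) / (Nat.choose (p + q) q : ℚ))
      = ∑ B ∈ PerFlat.Uq M p q, price M q u B := by
        rw [Finset.sum_congr rfl (fun B hB => price_of_mem_Uq hu hB), Finset.sum_const, nsmul_eq_mul]
    _ ≤ ∑ B ∈ Rq M q, price M q u B :=
        Finset.sum_le_sum_of_subset_of_nonneg (Uq_subset_Rq p q) (fun B _ _ => price_nonneg q u B)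
    _ ≤ ((Shadow.levelSet M u).card : ℚ) := h

end Profile

/-- **C025Profile = THE PROFILE INEQUALITY for every finite matroid and every `q < u`** (night-3 g6, NIGHT3-G6-PROFILE.md §1):
`#{S ⊆ E : ρ(S) = u} ≥ Σ_{B ⊆ E : ρ(B) = q, ρ(E ∖ B) ≥ u} C(ρ(B)+ρ(E∖B), u) / C(ρ(B)+ρ(E∖B), q)`. -/
def C025Profile : Prop :=
  ∀ {α : Type} [DecidableEq α] (M : Matroid α) [M.Finite] (q u : ℕ), q < u → Profile.ProfileIneq M q u

/-- **The bridge: the profile inequality implies `C025` at every `(p, q)`.** -/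
theorem c025_of_profile (h : C025Profile) : C025 := by
  intro α M _ p q hpq
  classical
  rw [PerFlat.ncard_Y_eq_card_Yq]
  have hY : ((PerFlat.Yq M p q).card : ℚ) = ∑ u ∈ Finset.Ioo q p, ((Shadow.levelSet M u).card : ℚ) := by
    exact_mod_cast Profile.card_Yq_eq_sum (M := M) p q
  calc phiK p q * ({A : Set α | A ⊆ M.E ∧ M.eRk A = (p : ℕ∞) ∧ M.eRk (M.E \ A) = (q : ℕ∞)}.ncard : ℚ)
      ≤ phiK p q * ((PerFlat.Uq M p q).card : ℚ) := by
        apply mul_le_mul_of_nonneg_left _ (Profile.phiK_nonneg p q)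
        exact_mod_cast PerFlat.ncard_U_le_card_Uq M p q
    _ = ∑ u ∈ Finset.Ioo q p,
          ((PerFlat.Uq M p q).card : ℚ) * ((Nat.choose (p + q) u : ℚ) / (Nat.choose (p + q) q : ℚ)) := by
        rw [Profile.phiK_eq_sum_levels, Finset.sum_mul]
        apply Finset.sum_congr rfl
        intro u _
        ring
    _ ≤ ∑ u ∈ Finset.Ioo q p, ((Shadow.levelSet M u).card : ℚ) := by
        apply Finset.sum_le_sum
        intro u hu
        rw [Finset.mem_Ioo] at hu
        exact Profile.card_Uq_mul_le_card_Lq hu.2.le (h M q u hu.1)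
    _ = ((PerFlat.Yq M p q).card : ℚ) := hY.symm

/-! ## The Hall form `ProfileHall` (H⁺) over night-2's shadow vocabulary, and its two bridges -/

/-- **ProfileHall = THE HALL / NORMALIZED-MATCHING FORM (H⁺)** (night-3 g6, NIGHT3-G6-PROFILE.md §2; a conjecture):
for every finite matroid, every `q < u` and EVERY family `𝒜` of rank-`q` sets, the rank-`u` sets above `𝒜`
(night-2's `Shadow.shadowLevel`) number at least the total profile price of `𝒜`. By max-flow/min-cut this is the
existence of a per-set fractional certificate with the free-matroid prices. `𝒜 = Profile.Rq M q` is `C025Profile`;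
`𝒜 ⊆ PerFlat.Uq M p q` is night-2's `Shadow.ShadowC025Level`. -/
def ProfileHall : Prop :=
  ∀ {α : Type} [DecidableEq α] (M : Matroid α) [M.Finite] (q u : ℕ), q < u →
    ∀ 𝒜 ⊆ Profile.Rq M q, ∑ B ∈ 𝒜, Profile.price M q u B ≤ ((Shadow.shadowLevel M u 𝒜).card : ℚ)

/-- `ProfileHall → C025Profile`: take `𝒜` = all rank-`q` sets; the shadow lies in the level. -/
theorem profile_of_profileHall (h : ProfileHall) : C025Profile := by
  intro α _ M _ q u hqu
  unfold Profile.ProfileIneq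
  calc ∑ B ∈ Profile.Rq M q, Profile.price M q u B
      ≤ ((Shadow.shadowLevel M u (Profile.Rq M q)).card : ℚ) := h M q u hqu _ (subset_refl _)
    _ ≤ ((Shadow.levelSet M u).card : ℚ) := by
        exact_mod_cast Finset.card_le_card (Finset.filter_subset _ _)

/-- `ProfileHall → ShadowC025Level`: restrict to families of bottom sets, where every price is `C(p+q,u)/C(p+q,p)`. -/
theorem shadowC025Level_of_profileHall (h : ProfileHall) : Shadow.ShadowC025Level := by
  intro α _ M _ p q u hqu hup 𝒜 h𝒜
  have hsub : 𝒜 ⊆ Profile.Rq M q := h𝒜.trans (Profile.Uq_subset_Rq p q)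
  have h1 := h M q u hqu 𝒜 hsub
  have h2 : ∑ B ∈ 𝒜, Profile.price M q u B =
      (𝒜.card : ℚ) * ((Nat.choose (p + q) u : ℚ) / (Nat.choose (p + q) p : ℚ)) := by
    rw [Finset.sum_congr rfl (fun B hB => Profile.price_of_mem_Uq hup.le (h𝒜 hB)), Finset.sum_const,
      nsmul_eq_mul, Nat.choose_symm_add]
  rw [mul_comm, ← h2]
  exact h1

end PercRepro
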